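import Summits.QuantumFields.YangMills.Theorems.LuscherReductionDressedRitzPolyakovLiftClusterFrame
import HarnessLib

/-!
# CLUSTER INDUCTION, part 2 — the induction over spectral clusters (F4 of `R6-DESIGN.md` ∕ `WAVE-2-BRIEFS.md` for S-PSCAL″ of crux `DressedRitz`,
# stmt-QuantumFields-20205, line «polyakovlift» r6; LEAD prover ym-lead-20205-polyakovlift g2)

Pure linear algebra.  `e : Fin M → E` orthonormal (exact eigenvectors, cluster label `cl : Fin M → ℕ` monotone), `Φ : Fin M → E` unit vectors (quasimodes, same
labels) with near-orthogonality `|⟪Φ_j, Φ_j′⟫| ≤ ε` (`j ≠ j′`) and the FIRST-MOMENT budget «mass of `Φ_j` outside the clusters `≤ cl j` is `≤ s + κ·(mass strictly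
below)»`.  Conclusion (★ `cluster_induction`): the mass of every `Φ_j` strictly below its cluster plus the mass outside `≤ cl j` is `≤ clusterDelta M κ ε s M`, an explicit
quantity `≤ (4A)^{M+1}(s + ε²)`, `A = 2M(1+κ)+1`, provided `M(ε + clusterDelta …) ≤ 1/2`.  Mechanism: strong induction on the index; the in-cluster projections of the
lower quasimodes form a frame of the lower block (part 1, `mass_le_two_mul_sum_inner_sq`), and `Φ_j` is `ε`-orthogonal to them.

HONEST FRAMING: linear algebra; nothing here bears on infinite volume, the continuum limit or the Clay gap.
References: Reed–Simon IV, Thm. XIII.1 [cite: ReedSimonIV1978, Thm. XIII.1].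
-/

set_option autoImplicit false

noncomputable section

open Finset Submodule Module
open scoped BigOperators RealInnerProductSpace

namespace Summit.QuantumFields.YangMills.Theorems.FemtoTransferGap.ClusterInd

/-! ## §1 The explicit recursion -/

/-- The recursion `δ_0 = s + A ε²`, `δ_{n+1} = s + A(ε + √δ_n)²`, `A = 2M(1+κ)+1`. [folklore] -/
def clusterDelta (M : ℕ) (κ ε s : ℝ) : ℕ → ℝ
  | 0 => s + (2 * M * (1 + κ) + 1) * ε ^ 2
  | n + 1 => s + (2 * M * (1 + κ) + 1) * (ε + Real.sqrt (clusterDelta M κ ε s n)) ^ 2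

variable {M : ℕ} {κ ε s : ℝ}

/-- `clusterDelta ≥ s ≥ 0`. [folklore] -/
theorem clusterDelta_nonneg (hκ : 0 ≤ κ) (hs : 0 ≤ s) (n : ℕ) : 0 ≤ clusterDelta M κ ε s n := by
  cases n <;> simp only [clusterDelta] <;> positivity

/-- `s ≤ clusterDelta n`. [folklore] -/
theorem le_clusterDelta (hκ : 0 ≤ κ) (n : ℕ) : s ≤ clusterDelta M κ ε s n := by
  have hA : (0:ℝ) ≤ 2 * M * (1 + κ) + 1 := by positivity
  cases n with
  | zero => simp only [clusterDelta]; nlinarith [sq_nonneg ε]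
  | succ n => simp only [clusterDelta]; nlinarith [sq_nonneg (ε + Real.sqrt (clusterDelta M κ ε s n))]

/-- `clusterDelta` is monotone in `n` (for `ε ≥ 0`). [folklore] -/
theorem clusterDelta_mono (hκ : 0 ≤ κ) (hε : 0 ≤ ε) (hs : 0 ≤ s) : Monotone (clusterDelta M κ ε s) := by
  refine monotone_nat_of_le_succ fun n => ?_
  have hA : (1 : ℝ) ≤ 2 * M * (1 + κ) + 1 := by nlinarith [show (0:ℝ) ≤ M from Nat.cast_nonneg M]
  have hd := clusterDelta_nonneg (M := M) (ε := ε) hκ hs n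
  show clusterDelta M κ ε s n ≤ clusterDelta M κ ε s (n + 1)
  simp only [clusterDelta]
  have h1 : clusterDelta M κ ε s n ≤ (ε + Real.sqrt (clusterDelta M κ ε s n)) ^ 2 := by
    have := Real.sq_sqrt hd
    nlinarith [Real.sqrt_nonneg (clusterDelta M κ ε s n)]
  nlinarith

/-- The step inequality packaged: `s + (1+κ)·2M(ε + √d)² ≤ clusterDelta (n+1)` whenever `d ≤ clusterDelta n`. [folklore] -/
theorem clusterDelta_step (hκ : 0 ≤ κ) (hε : 0 ≤ ε) {n : ℕ} {d : ℝ} (hd : d ≤ clusterDelta M κ ε s n) :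
    s + (1 + κ) * (2 * M * (ε + Real.sqrt d) ^ 2) ≤ clusterDelta M κ ε s (n + 1) := by
  simp only [clusterDelta]
  have h1 : Real.sqrt d ≤ Real.sqrt (clusterDelta M κ ε s n) := Real.sqrt_le_sqrt hd
  have h2 : (ε + Real.sqrt d) ^ 2 ≤ (ε + Real.sqrt (clusterDelta M κ ε s n)) ^ 2 := by
    apply pow_le_pow_left₀ (by positivity); linarith
  have hM : (0 : ℝ) ≤ M := Nat.cast_nonneg M
  set X := (ε + Real.sqrt d) ^ 2
  set Y := (ε + Real.sqrt (clusterDelta M κ ε s n)) ^ 2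
  have hY0 : 0 ≤ Y := sq_nonneg _
  have hk1 : 0 ≤ 2 * M * (1 + κ) := by positivity
  calc s + (1 + κ) * (2 * M * X) = s + (2 * M * (1 + κ)) * X := by ring
    _ ≤ s + (2 * M * (1 + κ)) * Y := by nlinarith [mul_le_mul_of_nonneg_left h2 hk1]
    _ ≤ s + (2 * M * (1 + κ) + 1) * Y := by nlinarith

/-! ## §2 Pythagoras for the in-cluster projection -/

variable {E : Type*} [NormedAddCommGroup E] [InnerProductSpace ℝ E]

/-- For an orthonormal family on a finset `S`: with `u = Σ_{m∈S} ⟪x,e_m⟫ e_m`, `⟪x, u⟫ = ‖u‖² = Σ_{m∈S} ⟪x,e_m⟫²` and `‖x − u‖² = ‖x‖² − Σ_{m∈S}⟪x,e_m⟫²`. [folklore] -/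
theorem proj_facts {e : Fin M → E} (he : Orthonormal ℝ e) (S : Finset (Fin M)) (x : E) :
    ⟪x, ∑ m ∈ S, ⟪x, e m⟫ • e m⟫ = ∑ m ∈ S, ⟪x, e m⟫ ^ 2 ∧
      ‖∑ m ∈ S, ⟪x, e m⟫ • e m‖ ^ 2 = ∑ m ∈ S, ⟪x, e m⟫ ^ 2 ∧
      ‖x - ∑ m ∈ S, ⟪x, e m⟫ • e m‖ ^ 2 = ‖x‖ ^ 2 - ∑ m ∈ S, ⟪x, e m⟫ ^ 2 := by
  have h1 : ⟪x, ∑ m ∈ S, ⟪x, e m⟫ • e m⟫ = ∑ m ∈ S, ⟪x, e m⟫ ^ 2 := by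
    rw [inner_sum]; refine sum_congr rfl fun m _ => ?_; rw [real_inner_smul_right, sq]
  have h2 : ‖∑ m ∈ S, ⟪x, e m⟫ • e m‖ ^ 2 = ∑ m ∈ S, ⟪x, e m⟫ ^ 2 := by
    rw [← real_inner_self_eq_norm_sq, sum_inner]
    refine sum_congr rfl fun m hm => ?_
    rw [real_inner_smul_left, inner_sum]
    simp only [real_inner_smul_right, orthonormal_iff_ite.1 he, mul_ite, mul_one, mul_zero, Finset.sum_ite_eq, hm, if_true, sq]
  refine ⟨h1, h2, ?_⟩
  set w := ∑ m ∈ S, ⟪x, e m⟫ • e m with hw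
  have e1 : ⟪w, x⟫ = ∑ m ∈ S, ⟪x, e m⟫ ^ 2 := by rw [real_inner_comm]; exact h1
  have e2 : ⟪w, w⟫ = ∑ m ∈ S, ⟪x, e m⟫ ^ 2 := by rw [real_inner_self_eq_norm_sq]; exact h2
  have e3 : ⟪x, x⟫ = ‖x‖ ^ 2 := real_inner_self_eq_norm_sq x
  rw [← real_inner_self_eq_norm_sq, inner_sub_left, inner_sub_right, inner_sub_right, h1, e1, e2, e3]
  ring

/-! ## §3 ★ The induction -/

/-- ★★ **CLUSTER INDUCTION.**  `e` orthonormal, `cl` monotone, `Φ_j` unit with `|⟪Φ_j,Φ_j′⟫| ≤ ε` (`j ≠ j′`) and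
`1 − Σ_{cl j′ ≤ cl j}⟪Φ_j,e_j′⟫² ≤ s + κ Σ_{cl j′ < cl j}⟪Φ_j,e_j′⟫²`; if `M(ε + clusterDelta M κ ε s M) ≤ 1/2` then for every `j`
`Σ_{cl j′ < cl j}⟪Φ_j,e_j′⟫² + (1 − Σ_{cl j′ ≤ cl j}⟪Φ_j,e_j′⟫²) ≤ clusterDelta M κ ε s j ≤ clusterDelta M κ ε s M`. [cite: ReedSimonIV1978, Thm. XIII.1] -/
theorem cluster_induction (hκ : 0 ≤ κ) (hε : 0 ≤ ε) (hs : 0 ≤ s) (e : Fin M → E) (he : Orthonormal ℝ e) (cl : Fin M → ℕ) (hcl : Monotone cl)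
    (Φ : Fin M → E) (hΦ1 : ∀ j, ‖Φ j‖ = 1) (hgram : ∀ j j', j ≠ j' → |⟪Φ j, Φ j'⟫| ≤ ε)
    (henergy : ∀ j, 1 - ∑ j' ∈ univ.filter (fun j' => cl j' ≤ cl j), ⟪Φ j, e j'⟫ ^ 2 ≤ s + κ * ∑ j' ∈ univ.filter (fun j' => cl j' < cl j), ⟪Φ j, e j'⟫ ^ 2)
    (hsmall : (M : ℝ) * (ε + clusterDelta M κ ε s M) ≤ 1 / 2) (j : Fin M) :
    (∑ j' ∈ univ.filter (fun j' => cl j' < cl j), ⟪Φ j, e j'⟫ ^ 2) + (1 - ∑ j' ∈ univ.filter (fun j' => cl j' ≤ cl j), ⟪Φ j, e j'⟫ ^ 2)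
      ≤ clusterDelta M κ ε s j := by
  -- notation
  let lo : Fin M → ℝ := fun j => ∑ j' ∈ univ.filter (fun j' => cl j' < cl j), ⟪Φ j, e j'⟫ ^ 2
  let inn : Fin M → ℝ := fun j => ∑ j' ∈ univ.filter (fun j' => cl j' = cl j), ⟪Φ j, e j'⟫ ^ 2
  let le : Fin M → ℝ := fun j => ∑ j' ∈ univ.filter (fun j' => cl j' ≤ cl j), ⟪Φ j, e j'⟫ ^ 2
  let u : Fin M → E := fun l => ∑ m ∈ univ.filter (fun m => cl m = cl l), ⟪Φ l, e m⟫ • e m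
  have hle_split : ∀ j, le j = lo j + inn j := by
    intro j
    simp only [le, lo, inn]
    rw [← sum_filter_add_sum_filter_not (univ.filter fun j' => cl j' ≤ cl j) (fun j' => cl j' < cl j)]
    congr 1
    · congr 1; ext j'; simp only [mem_filter, mem_univ, true_and]; constructor
      · rintro ⟨_, h⟩; exact h
      · intro h; exact ⟨h.le, h⟩
    · congr 1; ext j'; simp only [mem_filter, mem_univ, true_and, not_lt]; constructor
      · rintro ⟨h1, h2⟩; exact le_antisymm h1 h2
      · intro h; exact ⟨h.le, h.ge⟩
  -- Pythagoras: ‖Φ_l − u_l‖² = 1 − in_l = lo_l + (1 − le_l)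
  have hpyth : ∀ l, ‖Φ l - u l‖ ^ 2 = lo l + (1 - le l) := by
    intro l
    obtain ⟨-, -, h3⟩ := proj_facts he (univ.filter fun m => cl m = cl l) (Φ l)
    show ‖Φ l - u l‖ ^ 2 = lo l + (1 - le l)
    rw [h3, hΦ1, one_pow, hle_split]; ring
  have hu_inner : ∀ l x, ⟪x, u l⟫ = ∑ m ∈ univ.filter (fun m => cl m = cl l), ⟪x, e m⟫ * ⟪Φ l, e m⟫ := by
    intro l x; simp only [u, inner_sum, real_inner_smul_right]; refine sum_congr rfl fun m _ => ?_; ring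
  -- strong induction on the index
  suffices H : ∀ n : ℕ, ∀ j : Fin M, (j : ℕ) = n → lo j + (1 - le j) ≤ clusterDelta M κ ε s n by exact H j j rfl
  intro n
  induction n using Nat.strong_induction_on with
  | _ n IH =>
    intro j hj
    have hmono := clusterDelta_mono (M := M) hκ hε hs
    -- δmax := clusterDelta (n − 1) bounds every lower index; use clusterDelta M as a uniform cap for smallness
    have hδM : ∀ l : Fin M, (l : ℕ) < n → lo l + (1 - le l) ≤ clusterDelta M κ ε s (n - 1) := by
      intro l hl
      have := IH l hl l rfl
      exact this.trans (hmono (Nat.le_pred_of_lt hl))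
    have hcapM : clusterDelta M κ ε s (n - 1) ≤ clusterDelta M κ ε s M := hmono (by omega)
    set dmax := clusterDelta M κ ε s (n - 1) with hdmax
    have hdmax0 : 0 ≤ dmax := clusterDelta_nonneg hκ hs _
    -- the lower index type
    let ι := {l : Fin M // cl l < cl j}
    have hιlt : ∀ l : ι, ((l : Fin M) : ℕ) < n := by
      intro l
      have : ¬ (j ≤ (l : Fin M)) := fun h => absurd (hcl h) (not_le.2 l.2)
      rw [← hj]; exact_mod_cast lt_of_not_ge this
    -- frame data on ι
    let e' : ι → E := fun l => e l
    let u' : ι → E := fun l => u l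
    have he' : Orthonormal ℝ e' := he.comp _ Subtype.val_injective
    have hu'mem : ∀ l : ι, u' l ∈ span ℝ (Set.range e') := by
      intro l
      refine sum_mem fun m hm => smul_mem _ _ (subset_span ⟨⟨m, ?_⟩, rfl⟩)
      have hm' : cl m = cl (l : Fin M) := (mem_filter.1 hm).2
      show cl m < cl j
      rw [hm']; exact l.2
    -- ‖Φ_l − u_l‖ ≤ √dmax for lower l
    have hres : ∀ l : ι, ‖Φ l - u l‖ ^ 2 ≤ dmax := fun l => by rw [hpyth]; exact hδM l (hιlt l)
    have hres' : ∀ l : ι, ‖Φ l - u l‖ ≤ Real.sqrt dmax := fun l => by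
      rw [← Real.sqrt_sq (norm_nonneg _)]; exact Real.sqrt_le_sqrt (hres l)
    -- Gram of u′
    have hG : ∀ l m : ι, |⟪u' l, u' m⟫ - if l = m then 1 else 0| ≤ ε + dmax := by
      intro l m
      by_cases hc : cl (l : Fin M) = cl (m : Fin M)
      · -- same cluster: ⟪Φ_l,Φ_m⟫ = ⟪u_l,u_m⟫ + ⟪Φ_l − u_l, Φ_m − u_m⟫
        have hdec : ⟪Φ l, Φ m⟫ = ⟪u' l, u' m⟫ + ⟪Φ l - u l, Φ m - u m⟫ := by
          have h1 : ⟪u l, Φ m - u m⟫ = 0 := by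
            show ⟪u l, Φ m - u m⟫ = 0
            rw [real_inner_comm, hu_inner, ]
            refine sum_eq_zero fun k hk => ?_
            have hk' : cl k = cl (m : Fin M) := by rw [(mem_filter.1 hk).2, hc]
            have : ⟪Φ m - u m, e k⟫ = 0 := by
              rw [inner_sub_left, real_inner_comm (e k) (u m), hu_inner]
              simp only [orthonormal_iff_ite.1 he, ite_mul, one_mul, zero_mul, Finset.sum_ite_eq, mem_filter, mem_univ, true_and, hk', if_true, sub_self]
            rw [this, zero_mul]
          have h2 : ⟪Φ l - u l, u m⟫ = 0 := by
            rw [hu_inner]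
            refine sum_eq_zero fun k hk => ?_
            have hk' : cl k = cl (l : Fin M) := by rw [(mem_filter.1 hk).2, ← hc]
            have : ⟪Φ l - u l, e k⟫ = 0 := by
              rw [inner_sub_left, real_inner_comm (e k) (u l), hu_inner]
              simp only [orthonormal_iff_ite.1 he, ite_mul, one_mul, zero_mul, Finset.sum_ite_eq, mem_filter, mem_univ, true_and, hk', if_true, sub_self]
            rw [this, zero_mul]
          have : Φ l = u l + (Φ l - u l) := by abel
          calc ⟪Φ l, Φ m⟫ = ⟪u l + (Φ l - u l), u m + (Φ m - u m)⟫ := by rw [← this]; congr 1; abel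
            _ = ⟪u' l, u' m⟫ + ⟪Φ l - u l, Φ m - u m⟫ := by
                rw [inner_add_left, inner_add_right, inner_add_right, h1, h2]; simp [u']
        have hcross : |⟪Φ l - u l, Φ m - u m⟫| ≤ dmax := by
          calc |⟪Φ l - u l, Φ m - u m⟫| ≤ ‖Φ l - u l‖ * ‖Φ m - u m‖ := abs_real_inner_le_norm _ _
            _ ≤ Real.sqrt dmax * Real.sqrt dmax := mul_le_mul (hres' l) (hres' m) (norm_nonneg _) (Real.sqrt_nonneg _)
            _ = dmax := Real.mul_self_sqrt hdmax0
        by_cases hlm : l = m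
        · subst hlm
          simp only [if_true]
          have : ⟪u' l, u' l⟫ - 1 = -⟪Φ l - u l, Φ l - u l⟫ := by
            have hn : ⟪Φ l, Φ l⟫ = 1 := by rw [real_inner_self_eq_norm_sq, hΦ1, one_pow]
            linarith [hdec]
          rw [this, abs_neg]; linarith [hcross]
        · rw [if_neg hlm, sub_zero]
          have hne : (l : Fin M) ≠ (m : Fin M) := fun h => hlm (Subtype.ext h)
          have := hgram _ _ hne
          rw [hdec] at this
          calc |⟪u' l, u' m⟫| = |⟪Φ l, Φ m⟫ - ⟪Φ l - u l, Φ m - u m⟫| := by rw [hdec]; ring_nf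
            _ ≤ |⟪Φ l, Φ m⟫| + |⟪Φ l - u l, Φ m - u m⟫| := abs_sub _ _
            _ ≤ ε + dmax := add_le_add (hgram _ _ hne) hcross
      · -- different clusters: exactly orthogonal
        have hlm : l ≠ m := fun h => hc (by rw [h])
        rw [if_neg hlm, sub_zero]
        have : ⟪u' l, u' m⟫ = 0 := by
          show ⟪u l, u m⟫ = 0
          rw [hu_inner]
          refine sum_eq_zero fun k hk => ?_
          have hk' : cl k = cl (m : Fin M) := (mem_filter.1 hk).2
          have : ⟪u l, e k⟫ = 0 := by
            rw [real_inner_comm, hu_inner]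
            refine sum_eq_zero fun k' hk'2 => ?_
            have hk'' : cl k' = cl (l : Fin M) := (mem_filter.1 hk'2).2
            have hne : k ≠ k' := fun h => hc (by rw [← hk'', ← h, hk'])
            rw [orthonormal_iff_ite.1 he, if_neg hne, zero_mul]
          rw [this, zero_mul]
        rw [this, abs_zero]; positivity
    -- smallness for the frame lemma
    have hcard : (Fintype.card ι : ℝ) ≤ M := by
      have := Fintype.card_subtype_le (fun l : Fin M => cl l < cl j)
      simp only [Fintype.card_fin] at this
      exact_mod_cast this
    have hρ0 : 0 ≤ ε + dmax := by positivity
    have hn : (Fintype.card ι : ℝ) * (ε + dmax) ≤ 1 / 2 := by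
      calc (Fintype.card ι : ℝ) * (ε + dmax) ≤ M * (ε + clusterDelta M κ ε s M) :=
            mul_le_mul hcard (by linarith [hcapM]) hρ0 (Nat.cast_nonneg M)
        _ ≤ 1 / 2 := hsmall
    -- the frame bound for lo_j
    have hframe := mass_le_two_mul_sum_inner_sq e' u' he' hu'mem hρ0 hG hn (Φ j)
    have hlo_eq : lo j = ∑ m : ι, ⟪Φ j, e' m⟫ ^ 2 := by
      show (∑ j' ∈ univ.filter (fun j' => cl j' < cl j), ⟪Φ j, e j'⟫ ^ 2) = _
      exact Finset.sum_subtype (univ.filter (fun j' => cl j' < cl j)) (fun j' => by simp) (fun j' => ⟪Φ j, e j'⟫ ^ 2)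
    have hinner_u : ∀ l : ι, |⟪Φ j, u' l⟫| ≤ ε + Real.sqrt dmax := by
      intro l
      have hne : j ≠ (l : Fin M) := fun h => absurd l.2 (by rw [← h]; exact lt_irrefl _)
      have : ⟪Φ j, u' l⟫ = ⟪Φ j, Φ l⟫ - ⟪Φ j, Φ l - u l⟫ := by rw [inner_sub_right]; simp [u']
      rw [this]
      calc |⟪Φ j, Φ l⟫ - ⟪Φ j, Φ l - u l⟫| ≤ |⟪Φ j, Φ l⟫| + |⟪Φ j, Φ l - u l⟫| := abs_sub _ _
        _ ≤ ε + ‖Φ j‖ * ‖Φ l - u l‖ := add_le_add (hgram _ _ hne) (abs_real_inner_le_norm _ _)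
        _ ≤ ε + Real.sqrt dmax := by rw [hΦ1, one_mul]; linarith [hres' l]
    have hsum_u : ∑ l : ι, ⟪Φ j, u' l⟫ ^ 2 ≤ Fintype.card ι * (ε + Real.sqrt dmax) ^ 2 := by
      calc ∑ l : ι, ⟪Φ j, u' l⟫ ^ 2 ≤ ∑ _l : ι, (ε + Real.sqrt dmax) ^ 2 :=
            sum_le_sum fun l _ => by
              rw [← sq_abs]; exact pow_le_pow_left₀ (abs_nonneg _) (hinner_u l) 2
        _ = Fintype.card ι * (ε + Real.sqrt dmax) ^ 2 := by rw [sum_const, card_univ, nsmul_eq_mul]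
    have hlo : lo j ≤ 2 * M * (ε + Real.sqrt dmax) ^ 2 := by
      rw [hlo_eq]
      calc ∑ m : ι, ⟪Φ j, e' m⟫ ^ 2 ≤ 2 * ∑ l : ι, ⟪Φ j, u' l⟫ ^ 2 := hframe
        _ ≤ 2 * (Fintype.card ι * (ε + Real.sqrt dmax) ^ 2) := by linarith [hsum_u]
        _ ≤ 2 * (M * (ε + Real.sqrt dmax) ^ 2) := by nlinarith [hcard, sq_nonneg (ε + Real.sqrt dmax)]
        _ = 2 * M * (ε + Real.sqrt dmax) ^ 2 := by ring
    -- the energy budget closes the step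
    have hout : 1 - le j ≤ s + κ * lo j := henergy j
    show lo j + (1 - le j) ≤ clusterDelta M κ ε s n
    rcases n with _ | n
    · -- no lower indices: lo = 0
      have hι : IsEmpty ι := ⟨fun l => absurd (hιlt l) (Nat.not_lt_zero _)⟩
      have hlo0 : lo j = 0 := by rw [hlo_eq]; exact Fintype.sum_empty _
      simp only [clusterDelta]
      rw [hlo0] at hout ⊢
      nlinarith [sq_nonneg ε, show (0:ℝ) ≤ 2 * M * (1 + κ) + 1 by positivity]
    · have hstep := clusterDelta_step (M := M) (s := s) hκ hε (le_refl dmax)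
      simp only [Nat.succ_sub_one] at hstep hdmax
      calc lo j + (1 - le j) ≤ lo j + (s + κ * lo j) := by linarith
        _ = s + (1 + κ) * lo j := by ring
        _ ≤ s + (1 + κ) * (2 * M * (ε + Real.sqrt dmax) ^ 2) := by
            have : 0 ≤ 1 + κ := by linarith
            nlinarith [hlo]
        _ ≤ clusterDelta M κ ε s (n + 1) := hstep

end Summit.QuantumFields.YangMills.Theorems.FemtoTransferGap.ClusterInd

end
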